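import Literature.NumberTheory.EllipticCurves.Rank1Residual.Typed.PAdicCertificateGoodOrdinary
import Literature.NumberTheory.EllipticCurves.SkinnerUrban2014.PAdicUnitPeriodRatioProofs
import Literature.NumberTheory.EllipticCurves.Rank1Residual.X9NoEntry
import Literature.NumberTheory.EllipticCurves.Wuthrich2014.ThreeAdicImageSupersingularProofs
import Summits.BirchSwinnertonDyer.Rank1Residual.Partition.Rows
import HarnessLib

/-!
# Row C16 at `p = 3` (scoreboard row D3), rank one, WITHOUT Beilinson–Flach and WITHOUT a partner:
# `BSD(E,3)` from Kato's divisibility and ONE per-curve 3-adic leading-term certificate, with the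
# period unit DISCHARGED by Mazur 1978 (cell `bsd-litref`, paper sub-dir `yz26`, seat
# `bsd-litref-yz26-pv`; LADDER-BSD H0/H1 · W7, row D3)

HONEST FRAMING (programme `BSD-LIT2PART-PROGRAMME-v1.md` §HONESTY, verbatim): «no tranche here
proves BSD; ARM L moves the LITERAL column of an r ≤ 1 census into the
kernel-proved-modulo-named-print column; ARM P changes what «named print» is worth.» Theorems only:
no definition, no new named fact; every published theorem enters as one of the tree's EXISTING named
facts, taken as a hypothesis. PER CURVE (certificate-shaped inputs); NOT a class theorem; nothing
here changes a label or a verdict; the lane books.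

## What and why

Row C16 = `RowC16 W 3` (`3` good ordinary, `E[3]` irreducible, `surj(3) ∨ ram(3)`; 5 437 register
classes carry the literal flag `YZ26@3-BF-ERL-Ohta`, 5 258 of them of rank one, 5 184 of those with
`3 ∤ #Ш_an`). The x10 cell's THIRD per-curve route for X10a′ ∧ r = 1 at `p = 3`
(`Literature/…/Rank1Residual/Typed/PAdicCertificateGoodOrdinary.lean`, p184219 lineage:
Kato 2004 Thm. 17.4 (3) + Perrin-Riou–Schneider as printed by Balakrishnan–Müller–Stein 2016
Thm. 1.7 + Gross–Zagier–Kolyvagin + Wuthrich 2014 Lemma 20, with the per-curve COMPUTED data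
`ord_{T=0} L₃(f, α) = r_an` and ONE valuation equality) is stated there either for `f`'s own
normalisation (`hcert` on `[T^r]L_p(f, α)`, period `Ω⁺_f`) or, in the `E`-normalisation the engines
compute (`ϖ · [T^r]L_p`, `ϖ · Ω_E = Ω⁺_f`), with the period unit `ord_p ϖ = 0` as a per-curve
HYPOTHESIS (`noPTorsion_of_kato_of_leadingTerm_certificate_of_periodUnit`, binder `hϖv`). ON ROW C16
THAT HYPOTHESIS IS A THEOREM OF THE PUBLISHED RECORD: at an odd good prime with `E[p]` irreducible,
`ord_p(Ω⁺_f/Ω_E) = 0` for the newform of `E` at level `N_E` (Mazur 1978 Cor. 4.1 — the tree's named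
fact `mazur_not_dvd_maninConstant_of_odd`, through `SkinnerUrban2014.periodUnit_of_mazur`, exactly
as the rank-`0` theorems of the cell and `X10CongruenceTransferUnitCoeff.lean` use it). This file
re-derives the route for row C16 with that hypothesis discharged and the row's own predicate as the
class hypothesis (`surj(3) ∨ ram(3)` gives `surj(3)` by `surj_of_irr_of_ram`; `3`-adic surjectivity
then by Wuthrich's Lemma 20), so that a per-curve record needs exactly: the newform `f` of `E` at
level `N_E`, the period scalar `ϖ` (documentation of the engines' normalisation), THE canonical
`3`-adic height datum, the two computed certificate lines `hord` / `hcert`, and the lane's exact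
`#Ш_an` with `3 ∤ #Ш_an`.

* `RowC16.bsdp_three_of_kato_of_leadingTerm_certificate` — analytic rank `≤ 1`, `E`-normalised
  leading coefficient, period unit discharged by Mazur.
* `RowC16.bsdp_three_rankOne_of_kato_certificate` — the rank-one reading (`r_an = 1` substituted:
  `ord_{T=0} L₃ = 1` and the `[T¹]` valuation line), the shape of the cell's certificate tables
  (`pub/bsd-litref/yz26/census/`: L-side msengine Riemann sums at level `3ⁿ`, regulator side PARI
  `ellpadicregulator` = `−6 · h_MST` of the PARI-free σ-engine).

Named facts (all PUBLISHED, all already in the tree, `p = 3` inside every printed range):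
`kato_divisibility` (per curve and datum, [Kato2004Asterisque] Thm. 17.4 (3)),
`Schneider1985_order_charGenerator_odd` ([BalakrishnanMullerStein2015] Thm. 1.7, `p > 2`),
`rank_eq_analyticRank_of_analyticRank_le_one` (GZK), `lemma20_surjective_threeAdic_of_semistable`
([Wuthrich2014] Lemma 20), `mazur_not_dvd_maninConstant_of_odd` ([Mazur1978] Cor. 4.1). No
Skinner–Urban, no Beilinson–Flach, no Yan–Zhu input; no partner curve.

References: [Kato2004Asterisque] Thm. 17.4 (3) (p. 273); [BalakrishnanMullerStein2015] Thm. 1.7;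
[SteinWuthrich2013] §§3–4, §8; [Wuthrich2014] Lemma 20 (p. 400); [Mazur1978] Cor. 4.1;
[Miller2011LMS] Def. 1.1, Prop. 7.6; [GreenbergVatsal2000] §3 Remark 3.4 (period unit).
-/

set_option autoImplicit false

noncomputable section

open scoped Classical MatrixGroups ModularForm

open CongruenceSubgroup WeierstrassCurve Literature.NumberTheory.EllipticCurves
  Literature.NumberTheory.EllipticCurves.ModularForms
  Literature.NumberTheory.EllipticCurves.Rank1Residual
  Literature.NumberTheory.EllipticCurves.Rank1Residual.Typed
  Literature.NumberTheory.EllipticCurves.Wuthrich2014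

namespace Summit.BirchSwinnertonDyer.Rank1Residual

section Curve

variable (W : WeierstrassCurve ℚ) [W.IsElliptic] [W.IsGloballyMinimal]

/-- **Row C16 at `p = 3`, analytic rank `≤ 1`, `3 ∤ #Ш_an`: `BSD(E,3)` from Kato's divisibility and
the per-curve `3`-adic leading-term certificate in the engines' `E`-normalisation, with the period
unit discharged by Mazur 1978.** Class hypothesis: `RowC16 W 3`. Named facts: `hS` (BMS 2016 Thm.
1.7 / Schneider 1985), `hGZK`, `hW20` (Wuthrich 2014 Lemma 20), `hM` (Mazur 1978 Cor. 4.1), `hK`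
(Kato 2004 Thm. 17.4 for this curve, its newform and every cyclotomic datum). Per-curve data: the
newform `f` of `E` at level `N_E` (`hf`), the period scalar `ϖ` with `ϖ · Ω_E = Ω⁺_f` (`hϖ`), THE
canonical `3`-adic height datum (`Dh`, `hDh`), and the COMPUTED lines `hord`
(`ord_{T=0} L₃(f, α) = r_an`) and `hcert`
(`v(ϖ·[T^r]L₃ · log₃(γ)^r · #E(ℚ)_tors²) = v((1 − α⁻¹)² · ∏c_ℓ · Reg₃)`), plus the lane's exact
`#Ш_an` as a `3`-adic unit (`hs`, `hv`). Proof: `surj(3)` from the row (`surj_of_irr_of_ram` in the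
(ram) case), `3`-adic surjectivity by `hW20`, `ord_3 ϖ = 0` by `periodUnit_of_mazur`, then
`noPTorsion_of_kato_of_leadingTerm_certificate_of_periodUnit` and `bsdp_of_shaAn_unit_of_noPTorsion`.
PER CURVE; NOT a class theorem. [cite: Kato2004Asterisque, Thm. 17.4 (3) (p. 273)]
[cite: BalakrishnanMullerStein2015, Thm. 1.7] [cite: Wuthrich2014, Lemma 20 (p. 400)]
[cite: Mazur1978, Cor. 4.1] [cite: SteinWuthrich2013, §§3–4 and §8] -/
theorem RowC16.bsdp_three_of_kato_of_leadingTerm_certificate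
    (hS : Schneider1985_order_charGenerator_odd)
    (hGZK : rank_eq_analyticRank_of_analyticRank_le_one)
    (hW20 : lemma20_surjective_threeAdic_of_semistable)
    (hM : mazur_not_dvd_maninConstant_of_odd)
    [NeZero (W.conductorNorm ℤ)] (f : CuspForm (Gamma0 (W.conductorNorm ℤ)) 2)
    (hK : ∀ (κ : ZpExtension ℚ 3) (γ : Field.absoluteGaloisGroup ℚ),
      kato_divisibility W 3 (κ := κ) (γ := γ) (f := f))
    (h : RowC16 W 3) (hf : IsNewformOf W f) (hr : W.analyticRank ≤ 1)
    (ϖ : ℚ) (hϖ : (ϖ : ℝ) * W.realPeriodRat = plusPeriod f)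
    (Dh : PAdicHeightData W 3) (hDh : Dh.IsCanonical)
    (hord : (padicLFunction f (unitRoot W 3 : ℚ_[3])).order = W.analyticRank)
    (hcert : (((ϖ : ℚ) : ℚ_[3]) *
          PowerSeries.coeff W.analyticRank (padicLFunction f (unitRoot W 3 : ℚ_[3])) *
          (padicLog 3 (cyclotomicGenerator 3) ^ W.analyticRank * (W.torsionOrder : ℚ_[3]) ^ 2)).valuation =
        ((1 - (unitRoot W 3 : ℚ_[3])⁻¹) ^ 2 * (W.tamagawaProduct : ℚ_[3]) *
          padicRegulator Dh).valuation)
    {s : ℚ} (hs : shaAn W = (s : ℂ)) (hv : padicValRat 3 s = 0) : BSDp W 3 := by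
  obtain ⟨-, hgo, hirr, hsr⟩ := h
  -- `surj(3)` on the row, then `3`-adic surjectivity (Wuthrich 2014 Lemma 20 at a good `3`)
  have hsurj : Surj W 3 := by
    rcases hsr with hs3 | hram
    · exact hs3
    · exact surj_of_irr_of_ram W 3 hirr hram
  have hsurjpow : ∀ n : ℕ, W.HasSurjectiveModNGaloisRep (3 ^ n : ℕ) := hW20 W (Or.inl hgo.1) hsurj
  -- the period scalar is a `3`-adic unit (Mazur 1978 Cor. 4.1) and non-zero
  have hϖv : padicValRat 3 ϖ = 0 :=
    SkinnerUrban2014.periodUnit_of_mazur hM W 3 (by decide) hgo.1 hirr f hf ϖ hϖ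
  have hΩf : 0 < plusPeriod f := IsNewform0.plusPeriod_pos_holds hf.1 hf.coeffField_eq_bot
  have hϖ0 : ϖ ≠ 0 := by
    intro h0
    rw [h0, Rat.cast_zero, zero_mul] at hϖ
    exact hΩf.ne' hϖ.symm
  have hϖv' : ((ϖ : ℚ) : ℚ_[3]).valuation = 0 := by
    rw [Padic.valuation_ratCast, hϖv]
  -- rank = analytic rank (GZK), then the x10 cell's engine with the period unit
  have hrk : W.mordellWeilRank = W.analyticRank := (hGZK W hr).1
  refine bsdp_of_shaAn_unit_of_noPTorsion W 3 hGZK hr hs hv ?_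
  refine noPTorsion_of_kato_of_leadingTerm_certificate_of_periodUnit hS W 3 f hK (by decide) hgo.1
    hgo.2 hsurjpow hf ϖ hϖ hϖv' hϖ0 Dh hDh ?_ ?_
  · rw [hrk]; exact hord
  · rw [hrk]; exact hcert

/-- **Row C16 ∩ {r_an = 1} at `p = 3`: the rank-one certificate shape.** The same theorem with
`r_an = 1` substituted, i.e. with the two computed lines read literally as the engines print them:
`hord : ord_{T=0} L₃(f, α) = 1` and
`hcert : v(ϖ·[T¹]L₃(f, α) · log₃(γ) · #E(ℚ)_tors²) = v((1 − α⁻¹)² · ∏c_ℓ · Reg₃(Dh))` for THE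
canonical `3`-adic height (`Dh`; exists uniquely at the odd good ordinary prime `3`), together with
`3 ∤ #Ш_an`. With Kato's divisibility, `hord` alone already gives `Ш(E)[3^∞]` finite and the
canonical height NON-DEGENERATE (Schneider) — the regulator in `hcert` is therefore non-zero and its
valuation a finite computed number. PER CURVE; NOT a class theorem; the four class-level inputs are
PUBLISHED named facts, the lane's certificates are evidence for `hord`/`hcert`, never kernel facts.
[cite: Kato2004Asterisque, Thm. 17.4 (3) (p. 273)] [cite: BalakrishnanMullerStein2015, Thm. 1.7]
[cite: SteinWuthrich2013, §§3–4 and §8] [cite: Mazur1978, Cor. 4.1] -/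
theorem RowC16.bsdp_three_rankOne_of_kato_certificate
    (hS : Schneider1985_order_charGenerator_odd)
    (hGZK : rank_eq_analyticRank_of_analyticRank_le_one)
    (hW20 : lemma20_surjective_threeAdic_of_semistable)
    (hM : mazur_not_dvd_maninConstant_of_odd)
    [NeZero (W.conductorNorm ℤ)] (f : CuspForm (Gamma0 (W.conductorNorm ℤ)) 2)
    (hK : ∀ (κ : ZpExtension ℚ 3) (γ : Field.absoluteGaloisGroup ℚ),
      kato_divisibility W 3 (κ := κ) (γ := γ) (f := f))
    (h : RowC16 W 3) (hf : IsNewformOf W f) (hr1 : W.analyticRank = 1)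
    (ϖ : ℚ) (hϖ : (ϖ : ℝ) * W.realPeriodRat = plusPeriod f)
    (Dh : PAdicHeightData W 3) (hDh : Dh.IsCanonical)
    (hord : (padicLFunction f (unitRoot W 3 : ℚ_[3])).order = 1)
    (hcert : (((ϖ : ℚ) : ℚ_[3]) *
          PowerSeries.coeff 1 (padicLFunction f (unitRoot W 3 : ℚ_[3])) *
          (padicLog 3 (cyclotomicGenerator 3) * (W.torsionOrder : ℚ_[3]) ^ 2)).valuation =
        ((1 - (unitRoot W 3 : ℚ_[3])⁻¹) ^ 2 * (W.tamagawaProduct : ℚ_[3]) *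
          padicRegulator Dh).valuation)
    {s : ℚ} (hs : shaAn W = (s : ℂ)) (hv : padicValRat 3 s = 0) : BSDp W 3 := by
  refine RowC16.bsdp_three_of_kato_of_leadingTerm_certificate W hS hGZK hW20 hM f hK h hf
    (le_of_eq hr1) ϖ hϖ Dh hDh ?_ ?_ hs hv
  · rw [hr1]; exact_mod_cast hord
  · rw [hr1, pow_one]; exact hcert

/-- **Row C16 ∩ {r_an = 1} at `p = 3`: the rank-one certificate shape with Wuthrich's Lemma 20
ALSO discharged** — the `3`-adic surjectivity input is the tree THEOREM
`Wuthrich2014.lemma20_surjective_threeAdic_of_semistable_holds` (proved locally at `3`: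
inertia words in the ordinary case; `ThreeAdicImageSupersingularProofs.lean`), so the class-level
named facts left as hypotheses are exactly THREE published theorems — Kato 2004 Thm. 17.4 (3)
(`hK`, per curve and datum), Perrin-Riou–Schneider as printed by Balakrishnan–Müller–Stein 2016
Thm. 1.7 (`hS`), Gross–Zagier–Kolyvagin (`hGZK`) — plus Mazur 1978 Cor. 4.1 (`hM`) for the period
unit; per curve: `f`, `ϖ`, THE canonical height datum, `hord`, `hcert`, `3 ∤ #Ш_an`. PER CURVE;
NOT a class theorem. [cite: Kato2004Asterisque, Thm. 17.4 (3) (p. 273)]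
[cite: BalakrishnanMullerStein2015, Thm. 1.7] [cite: Wuthrich2014, Lemma 20 (p. 399)]
[cite: Mazur1978, Cor. 4.1] -/
theorem RowC16.bsdp_three_rankOne_of_kato_certificate'
    (hS : Schneider1985_order_charGenerator_odd)
    (hGZK : rank_eq_analyticRank_of_analyticRank_le_one)
    (hM : mazur_not_dvd_maninConstant_of_odd)
    [NeZero (W.conductorNorm ℤ)] (f : CuspForm (Gamma0 (W.conductorNorm ℤ)) 2)
    (hK : ∀ (κ : ZpExtension ℚ 3) (γ : Field.absoluteGaloisGroup ℚ),
      kato_divisibility W 3 (κ := κ) (γ := γ) (f := f))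
    (h : RowC16 W 3) (hf : IsNewformOf W f) (hr1 : W.analyticRank = 1)
    (ϖ : ℚ) (hϖ : (ϖ : ℝ) * W.realPeriodRat = plusPeriod f)
    (Dh : PAdicHeightData W 3) (hDh : Dh.IsCanonical)
    (hord : (padicLFunction f (unitRoot W 3 : ℚ_[3])).order = 1)
    (hcert : (((ϖ : ℚ) : ℚ_[3]) *
          PowerSeries.coeff 1 (padicLFunction f (unitRoot W 3 : ℚ_[3])) *
          (padicLog 3 (cyclotomicGenerator 3) * (W.torsionOrder : ℚ_[3]) ^ 2)).valuation =
        ((1 - (unitRoot W 3 : ℚ_[3])⁻¹) ^ 2 * (W.tamagawaProduct : ℚ_[3]) *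
          padicRegulator Dh).valuation)
    {s : ℚ} (hs : shaAn W = (s : ℂ)) (hv : padicValRat 3 s = 0) : BSDp W 3 :=
  RowC16.bsdp_three_rankOne_of_kato_certificate W hS hGZK
    Wuthrich2014.lemma20_surjective_threeAdic_of_semistable_holds hM f hK h hf hr1 ϖ hϖ Dh hDh hord
    hcert hs hv

end Curve

end Summit.BirchSwinnertonDyer.Rank1Residual

end
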